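import Summits.Langlands.Langlands.Theorems.IrreducibilityBySelfDualityPairLBoundaryJSThinLastRowTorusPoint
import Literature.NumberTheory.Automorphic.SmoothedFormCentralCharacter
import Literature.NumberTheory.Automorphic.RankinSelbergUnfoldedEulerCuspidal
import Literature.NumberTheory.Automorphic.WhittakerCoeffLocalDatum

/-!
# Crux `PairLBoundaryJS` (stmt-Langlands-13622), line `Sketch` — stub `stub_whittakerCoeff_smoothedForm_props` (L3):
# the abstract properties of the Whittaker coefficient of a smoothed level vector with a pure-tensor weight

Summit `Langlands`, sub-problem `Langlands`, helper file under `Theorems/` supporting the crux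
`PairLBoundaryJS` (Arthur–Clozel (1989), Ch. 3, (2.2)), line `Sketch`, registered stub
`stub_whittakerCoeff_smoothedForm_props`.

For a cuspidal automorphic representation `Π` of `GL_n(𝔸_K)`, a vector `f ∈ Π` fixed by the principal
congruence subgroup `K(𝔫')` (`𝔫' ≠ 0`) and the pure-tensor test function `η = β ⊗ 𝟙_{K_f(𝔫)}`
(`archLevelWeight (finitePrincipalCongruenceLevel n K 𝔫) β`), the global Whittaker coefficient
`W = W_{S_η f}` (Tate's character `ψ_K = adeleAddChar K`, a Haar measure `ν₀` on `N_n(𝔸_K)`, Tate's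
domain `unipotentTateDomain`) of the smoothed cusp form `S_η f` has the five properties consumed by the
abstract bridge `UnitBoxTranslateProductForm.stub_unitBox_translate_productForm`:

1. left `ψ`-equivariance under `N_n(𝔸_K)`: `W(u g) = ψ_N(u) W(g)` (tree `whittakerCoeff_unipotent_mul`,
   Cogdell (2004), §1.1);
2. constant modulus under the centre: `‖W(z g)‖ = ‖W(g)‖` (the unitary central character of `Π`,
   tree `CuspidalAutomorphicRepGL.exists_centralCharacter_smoothedForm`, and `whittakerCoeff_scalar_mul`);
3. right `(1, K_f(𝔫'))`-invariance and
4. right `ι_v(K_v(𝔭_v^{ord_v 𝔫'}))`-invariance at every finite place `v` (Bump (1997), Prop. 2.3.1: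
   `S_η f` is again `K(𝔫')`-fixed; tree `ThinLastRowTorusPoint.whittakerCoeff_smoothedForm_archLevelWeight_mul_ofFinite`,
   `…_mul_ofLocal`);
5. continuity of `W` on `GL_n(𝔸_K)` (the Whittaker integral of the continuous `invQuot (S_η f)` over the
   relatively compact Tate domain, tree `continuous_whittakerCoeff`).

All proofs complete; tree theorems only.

## References

* J. W. Cogdell, *Analytic theory of L-functions for GL_n*, in *An Introduction to the Langlands
  Program* (2004), §1.1, §1.2 [CogdellAnalyticTheory2004].
* D. Bump, *Automorphic Forms and Representations* (1997), Prop. 2.3.1, §3.3 [Bump1997].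
-/

noncomputable section

-- `Summit.Langlands.Langlands.…` (summit = sub-problem name, D-0017 layout) trips `dupNamespace`
set_option linter.dupNamespace false

open scoped MatrixGroups Topology Pointwise ENNReal NNReal ComplexConjugate InnerProductSpace ContDiff
-- the place subtypes indexing `mixedSpace K` are `Fintype` classically (`NormedCommRing (mixedSpace K)`)
open scoped Classical Matrix.Norms.Operator
open NumberField IsDedekindDomain MeasureTheory Measure Matrix Set Filter WithZero
open NumberField.mixedEmbedding
open Literature.NumberTheory.Automorphic AdelicGroupData
open Literature.NumberTheory.GaloisRepresentations (ideleGroup HeckeCharacter)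
open ValuativeRel

-- the automorphic quotient carries the tree's Borel σ-algebra, not Mathlib's quotient σ-algebra
attribute [-instance] Quotient.instMeasurableSpace QuotientGroup.measurableSpace

-- the house local instances, exactly as in `RankinSelbergUnfoldingIdentity`
attribute [local instance] adelicBorel borelSpace_adelic locallyCompactSpace_adelic secondCountableTopology_gl_adelic
  glAdeleBorel borelSpace_glAdele borelSpace_ideleGroup secondCountableTopology_ideleGroup

-- Mathlib idiom: the commutator Lie ring on matrices, to mention `(archGroupGL n K).lie`
attribute [local instance 100] LieRing.ofAssociativeRing

namespace Summit.Langlands.Langlands.Theorems.WhittakerCoeffSmoothedFormProps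

/-- **The abstract properties of the Whittaker coefficient of a smoothed level vector with a pure-tensor
weight.** For `f ∈ Π` fixed by `K(𝔫')` and the test function `η = β ⊗ 𝟙_{K_f(𝔫)}`:
`W = W_{S_η f}` is left `ψ`-equivariant under `N_n(𝔸_K)` (`whittakerCoeff_unipotent_mul`), has constant modulus under
central translation (unitary central character, `exists_centralCharacter_smoothedForm`, `whittakerCoeff_scalar_mul`), is
right invariant under `(1, K_f(𝔫'))` and under `ι_v` of the valued congruence subgroup of radius `|𝔫'|_v`
(`ThinLastRowTorusPoint.whittakerCoeff_smoothedForm_archLevelWeight_mul_ofFinite/ofLocal`), and is continuous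
(`continuous_invQuot_smoothedForm`, continuity of the Whittaker integral over the relatively compact Tate domain).
[cite: CogdellAnalyticTheory2004, §1.1] [folklore] -/
theorem stub_whittakerCoeff_smoothedForm_props :
    ∀ {n : ℕ} {K : Type} [Field K] [NumberField K]
      {μ : Measure (AdelicGroupData.gl n K).automorphicQuotient} [(AdelicGroupData.gl n K).IsAutomorphicMeasure μ]
      [MeasurableSpace (AdeleRing (𝓞 K) K)] [BorelSpace (AdeleRing (𝓞 K) K)]
      (P : CuspidalAutomorphicRepGL n K μ) (ν₀ : Measure ↥(adelicUnipotent n K)) [IsHaarMeasure ν₀]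
      {β : GL (Fin n) (mixedSpace K) → ℝ} {𝔫 𝔫' : Ideal (𝓞 K)} (_ : 𝔫' ≠ 0)
      (_ : IsTestFunctionGL n K (archLevelWeight (finitePrincipalCongruenceLevel n K 𝔫) β))
      (f : P.1.toSubmodule) (_ : ∀ g ∈ principalCongruenceLevel n K 𝔫', P.1.toContRep g f = f),
    (∀ (u : ↥(adelicUnipotent n K)) (g : GL (Fin n) (AdeleRing (𝓞 K) K)),
        whittakerCoeff ν₀ (unipotentTateDomain n K) (adeleAddChar K) (invQuot (AdelicGroupData.gl n K) (smoothedForm (archLevelWeight (finitePrincipalCongruenceLevel n K 𝔫) β) ((f : P.1.toSubmodule) : (AdelicGroupData.gl n K).L2 μ))) ((u : GL (Fin n) (AdeleRing (𝓞 K) K)) * g) =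
          whittakerCharFun (adeleAddChar K) u * whittakerCoeff ν₀ (unipotentTateDomain n K) (adeleAddChar K) (invQuot (AdelicGroupData.gl n K) (smoothedForm (archLevelWeight (finitePrincipalCongruenceLevel n K 𝔫) β) ((f : P.1.toSubmodule) : (AdelicGroupData.gl n K).L2 μ))) g) ∧
    (∀ (z : ideleGroup K) (g : GL (Fin n) (AdeleRing (𝓞 K) K)),
        ‖whittakerCoeff ν₀ (unipotentTateDomain n K) (adeleAddChar K) (invQuot (AdelicGroupData.gl n K) (smoothedForm (archLevelWeight (finitePrincipalCongruenceLevel n K 𝔫) β) ((f : P.1.toSubmodule) : (AdelicGroupData.gl n K).L2 μ))) (Matrix.GeneralLinearGroup.scalar (Fin n) z * g)‖ = ‖whittakerCoeff ν₀ (unipotentTateDomain n K) (adeleAddChar K) (invQuot (AdelicGroupData.gl n K) (smoothedForm (archLevelWeight (finitePrincipalCongruenceLevel n K 𝔫) β) ((f : P.1.toSubmodule) : (AdelicGroupData.gl n K).L2 μ))) g‖) ∧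
    (∀ u ∈ finitePrincipalCongruenceLevel n K 𝔫', ∀ g : GL (Fin n) (AdeleRing (𝓞 K) K),
        whittakerCoeff ν₀ (unipotentTateDomain n K) (adeleAddChar K) (invQuot (AdelicGroupData.gl n K) (smoothedForm (archLevelWeight (finitePrincipalCongruenceLevel n K 𝔫) β) ((f : P.1.toSubmodule) : (AdelicGroupData.gl n K).L2 μ))) (g * GLn.ofFinite n K u) = whittakerCoeff ν₀ (unipotentTateDomain n K) (adeleAddChar K) (invQuot (AdelicGroupData.gl n K) (smoothedForm (archLevelWeight (finitePrincipalCongruenceLevel n K 𝔫) β) ((f : P.1.toSubmodule) : (AdelicGroupData.gl n K).L2 μ))) g) ∧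
    (∀ (v : HeightOneSpectrum (𝓞 K)), ∀ κ ∈ valuedCongruenceSubgroup (Fin n) (idealRadius K v 𝔫'),
        ∀ g : GL (Fin n) (AdeleRing (𝓞 K) K), whittakerCoeff ν₀ (unipotentTateDomain n K) (adeleAddChar K) (invQuot (AdelicGroupData.gl n K) (smoothedForm (archLevelWeight (finitePrincipalCongruenceLevel n K 𝔫) β) ((f : P.1.toSubmodule) : (AdelicGroupData.gl n K).L2 μ))) (g * GLn.ofLocal n K v κ) = whittakerCoeff ν₀ (unipotentTateDomain n K) (adeleAddChar K) (invQuot (AdelicGroupData.gl n K) (smoothedForm (archLevelWeight (finitePrincipalCongruenceLevel n K 𝔫) β) ((f : P.1.toSubmodule) : (AdelicGroupData.gl n K).L2 μ))) g) ∧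
    Continuous fun g : GL (Fin n) (AdeleRing (𝓞 K) K) => whittakerCoeff ν₀ (unipotentTateDomain n K) (adeleAddChar K) (invQuot (AdelicGroupData.gl n K) (smoothedForm (archLevelWeight (finitePrincipalCongruenceLevel n K 𝔫) β) ((f : P.1.toSubmodule) : (AdelicGroupData.gl n K).L2 μ))) g := by
  intro n K _ _ μ _ _ _ P ν₀ _ β 𝔫 𝔫' h𝔫' hη f hfix
  haveI hν₀R : ν₀.IsMulRightInvariant := isMulRightInvariant_of_isHaarMeasure_adelicUnipotent ν₀
  have hηc : Continuous (archLevelWeight (finitePrincipalCongruenceLevel n K 𝔫) β) := hη.continuous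
  have hηs : HasCompactSupport (archLevelWeight (finitePrincipalCongruenceLevel n K 𝔫) β) := hη.hasCompactSupport
  -- left `GL_n(K)`-invariance of the continuous representative
  have hφinv : IsLeftInvariant (AdelicGroupData.gl n K)
      (invQuot (AdelicGroupData.gl n K) (smoothedForm (archLevelWeight (finitePrincipalCongruenceLevel n K 𝔫) β)
        ((f : P.1.toSubmodule) : (AdelicGroupData.gl n K).L2 μ))) :=
    isLeftInvariant_invQuot _ _
  -- the unitary central character of `Π`, read on the continuous representative of `S_η f`
  obtain ⟨ωc, hωu, -, -, -, -, hω⟩ := P.exists_centralCharacter_smoothedForm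
  refine ⟨fun u g => ?_, fun z g => ?_, fun u hu g => ?_, fun v κ hκ g => ?_, ?_⟩
  · -- (1) left `ψ`-equivariance
    exact whittakerCoeff_unipotent_mul (ν := ν₀) (𝓕 := unipotentTateDomain n K) (ψ := adeleAddChar K)
      (isFundamentalDomain_unipotentTateDomain ν₀) (isGlobalAddChar_adeleAddChar (K := K)) hφinv u g
  · -- (2) constant modulus under the centre
    rw [whittakerCoeff_scalar_mul (fun g => hω _ f z g), norm_mul, hωu z, one_mul]
  · -- (3) right `(1, K_f(𝔫'))`-invariance
    exact ThinLastRowTorusPoint.whittakerCoeff_smoothedForm_archLevelWeight_mul_ofFinite P.1 hηc hηs f hfix ν₀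
      (unipotentTateDomain n K) (adeleAddChar K) hu g
  · -- (4) right `ι_v(K_v(𝔭_v^{ord_v 𝔫'}))`-invariance
    exact ThinLastRowTorusPoint.whittakerCoeff_smoothedForm_archLevelWeight_mul_ofLocal P.1 h𝔫' hηc hηs f hfix ν₀
      (unipotentTateDomain n K) (adeleAddChar K) v hκ g
  · -- (5) continuity
    exact continuous_whittakerCoeff measurableSet_unipotentTateDomain isCompact_closure_unipotentTateDomain
      (isGlobalAddChar_adeleAddChar (K := K)).continuous (continuous_invQuot_smoothedForm hηc hηs _)

end Summit.Langlands.Langlands.Theorems.WhittakerCoeffSmoothedFormProps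

end
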